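import Summits.HodgeConjecture.HodgeConjecture.Theses.NikulinTwinTransport
import Literature.AlgebraicGeometry.Surfaces.K3TwistorLines
import Literature.AlgebraicGeometry.Surfaces.K3Marking
import Summits.HodgeConjecture.HodgeConjecture.Theorems.TwinTwistorTransport.Negative.GenericFirstLine
import Summits.HodgeConjecture.HodgeConjecture.Theorems.TwinTwistorTransport.Negative.AnchorConeCondition
import Summits.HodgeConjecture.HodgeConjecture.Theorems.TwinTwistorTransport.Negative.PolystableCrossTerm
import Summits.HodgeConjecture.HodgeConjecture.Theorems.TwinTwistorTransport.Negative.NikulinParity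

/-!
# Skeleton line `one-line-totally-real-reach` for crux `TwinTwistorTransport` (stmt-HodgeConjecture-14522)

Route `NikulinTwinTransport` (HodgeConjecture), crux r4, INFORMAL (no Lean signature yet): "K2 TRANSPORT
ALONG THE TWIN LOCUS — (a) Verbitsky/Kaledin–Verbitsky for the Ψ-matched product, (b) chains of generic
diagonal twistor lines, (c) GAGA endpoint; … with `HodgeIsometryAlgebraic` (Buskin) this is
X = `TwinSimilitudeAlgebraic`".  Planner seat `crux-plan`, idea card
`Cruxes/TwinTwistorTransport/Ideas/one-line-totally-real-reach.md` (ideator 1, round 1; triage r1: 3 × pass,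
"strongest of the eight"; merge target of `one-very-general-endpoint-hecke-spreading`).

## The line (period level; `Λ = Λ_K3`, `D = k3PeriodDomain`, `D_h = D ∩ h^⊥`, `B` the real form)

Fix the anchor period `σ ∈ D` and a lattice class `h` with `h² > 0` and `u₀ := (Im σ.h) Re σ − (Re σ.h) Im σ ≠ 0`
(`u₀` spans `P_σ ∩ h^⊥`).  ADMISSIBLE directions `v` (`v ⊥ u₀`, `v ⊥ h`, `v² = u₀²`, `⟨Re σ, Im σ, v⟩` positive)
give periods `x_{±v} := u₀ ± i v ∈ D_h` lying on the twistor line `T_{⟨Re σ, Im σ, v⟩}` through `σ`; every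
positive three-space through `P_σ` arises this way, and the two points `x_{±v}` are exactly `T_W ∩ h^⊥`
(`stub_reachGeometry`, R1–R3).  The reach set `R_h(σ) = {x_v}` is a real-analytic 19-fold in the complex
19-fold `ℙ(D_h)`, MAXIMAL TOTALLY REAL: at the cone level, `(c, δ) ↦ c·x_v + i δ` is a linear isomorphism
`ℂ × T_v Q_ℂ ≅ T_{x_v} C_h` (`stub_reachGeometry`, TR).  SPREAD (`stub_spread`, from the flat identity
principle `stub_identityPrinciple`): a predicate `P` on `D_h` whose locus is locally a countable union of
`ℂ*`-saturated closed analytic subsets (`LocusStructure`) and which holds at `x_{±v}` for `v` in a non-empty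
open set of admissible directions holds on ALL of `D_h` (Baire on the admissible set, analytic continuation off
the real form through the explicit chart `(c, t) ↦ c(u₀ + iλ(t)(v₁ + t))`, clopen propagation, the two
components of `D_h` being swapped by `v ↦ −v`).  The predicate is `GraphAlgebraicAt M x`: "for every marked
projective K3 `(S, φ, p)` with period `x` and every marked `(S′, φ′, p′)` with period `x′`, `M x′ = x`, the
2-similitude `φ⁻¹ ∘ M ∘ φ′ : H²(S′) → H²(S)` is `[γ]_*` for an algebraic `γ` on `S × S′`" (`M` a rational
2-similitude of `Λ_ℚ`; scheme-level, over the carriers of `TwinSimilitudeAlgebraic`).  Its locus has the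
required structure by relative Douady/Chow theory (`stub_locus`, typed statement, informal proof).  The ONE
geometric input is `stub_transport` (LOAD-BEARING, typed at outcome level, informal proof = crux 14464's
carrier + Kaledin–Verbitsky extension along ONE twistor line + GAGA at the two polarised points of the line):
an anchor `σ`, a similitude `M` and an OPEN set `U` of directions `ω` (the Ψ-matched Kähler cone) such that on
every line `T_{⟨Re σ, Im σ, ω⟩}`, `ω ∈ U`, graph-algebraicity holds at every point orthogonal to ANY `h` with
`h² > 0` — all degrees from one anchor, no chains, no nodes, no class switching (clause (b) deleted).  Finally
`stub_harvest` (formal debt): re-mark `S` so that its polarisation is good for `σ` (`O(Λ)` moves `h` off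
`P_σ^⊥`), build the `M`-partner by period surjectivity, and turn "graph algebraic on every good polarised period
domain" + Buskin into `TwinSimilitudeAlgebraic` (`ψ = ψ₀ ∘ (ψ₀⁻¹ψ)`, `ψ₀⁻¹ψ` a rational Hodge ISOMETRY,
composition of correspondences = Buskin Lemma 6.3, tree `K3CorrespondenceComposition`).

## What the skeleton concludes, and why (tooling note for the lead / tenure planner)

The crux item has NO Lean decl (informal), so nothing can conclude it "by name".  The skeleton concludes the
crux's OWN STATED OUTPUT, declared here as `CruxOutput := Huybrechts_K3_marking_exists →
Huybrechts_K3_periodSurjective_projective → HodgeIsometryAlgebraic → TwinSimilitudeAlgebraic` (the two period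
facts are the standard inputs of `TwinExists`; they are Literature facts, hence not admissible as bare
hypotheses of the audited theorem, hence inside the concluded `Prop`).  Register with
`ledger skeleton check … --crux stmt-HodgeConjecture-14522 --crux-decl
Summit.HodgeConjecture.HodgeConjecture.Cruxes.TwinTwistorTransport.OneLineTotallyRealReach.CruxOutput`.
`twinSimilitudeAlgebraic_of_line` is the same theorem with the route TARGET `TwinSimilitudeAlgebraic` as its
literal conclusion.  If the tenure planner files the two facts as rank-9 support items (as was done for
`HodgeIsometryAlgebraic` / `LefschetzOneOneK3`), re-point `--crux-decl` at the route target.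

## Disproof / negatives honoured (cdisprove gen-1/gen-2 notes; the four LANDED `Negative/` files are imported)
* F5 (refuted strengthening "one line joins two GIVEN periods"): never used — REACH prescribes no endpoint;
  `stub_reachGeometry` R2 only says every positive `W ⊇ P_σ` meets `D_h` in `x_{±v}`.
* F2 `Negative.GenericFirstLine.eq_zero_of_oneOne_along_generic_line`, F4 `exists_integral_perp_of_rational_ray`,
  F10: the hypothesis of the informal proof of `stub_transport` is hyperholomorphicity/stability of the 14464
  carrier for ALL matched classes of an OPEN cone `U` (Markman 2024 Prop. 5.19 (i)), never one rational ray;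
  consequences `c₁ = 0` (untwisted) / `J = 0` are consequences, not hypotheses (triage r1-3 F-E).
* F7 `Negative.PolystableCrossTerm.finrank_le_of_restrict_eq_smul`: the carrier is demanded STABLE (not
  polystable) in the informal spec of `stub_transport`.
* F9 `Negative.AnchorConeCondition.no_minusTwo_class_of_even_degree`: the anchor family is taken of EVEN degree
  `d`, so `𝒦_X = 𝒞⁺_X` and every Kähler `ω′` on `Y′` is admissible — `U = Ψ(𝒦_{Y′}) ∩ (stability cone)` is open
  and non-empty.
* F3 `Negative.NikulinParity.evenEight_ne_nodal_add_two_smul`: concerns the carrier recipe (14464), not this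
  line; the informal spec allows twisted (κ-class) transport along the one line.
* gen-1 "Ψ never integral, 2Ψ integral, m even": `M` is a RATIONAL 2-similitude (`IsTwoSimilitude` over `ℚ`),
  no integrality is assumed anywhere; `m` lives only inside the informal proof of `stub_transport`.
* Negatives index (`ledger negatives --problem HodgeConjecture`): the ELineTransport lattice-connectivity
  refutation (22×22 matrix item) is not an instance of any stub (no connectivity statement here).
-/

set_option linter.dupNamespace false

noncomputable section

open CategoryTheory
open Literature.AlgebraicGeometry
open Literature.AlgebraicGeometry.Surfaces
open Literature.AlgebraicTopology.SingularHomology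
open Summit.HodgeConjecture.HodgeConjecture.Theses.NikulinTwinTransport

namespace Summit.HodgeConjecture.HodgeConjecture.Cruxes.TwinTwistorTransport.OneLineTotallyRealReach

/-! ### §0 Notation (copy verbatim into any file proving a stub) -/

/-- The real K3 form `(u.w) = Σ uᵢ Λᵢⱼ wⱼ` on `Λ_ℝ = K3Index → ℝ` (as in `K3TwistorLines`). -/
abbrev bR : LinearMap.BilinForm ℝ (K3Index → ℝ) := Matrix.toBilin' (k3Gram.map (Int.cast : ℤ → ℝ))

/-- Real part of a complex vector. -/
abbrev reV (x : K3Index → ℂ) : K3Index → ℝ := fun i => (x i).re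
/-- Imaginary part of a complex vector. -/
abbrev imV (x : K3Index → ℂ) : K3Index → ℝ := fun i => (x i).im
/-- A real vector as a complex vector. -/
abbrev ofR (w : K3Index → ℝ) : K3Index → ℂ := fun i => (w i : ℂ)
/-- A lattice vector as a complex vector. -/
abbrev ofZ (v : K3Index → ℤ) : K3Index → ℂ := fun i => (v i : ℂ)
/-- A lattice vector as a real vector. -/
abbrev ofZR (v : K3Index → ℤ) : K3Index → ℝ := fun i => (v i : ℝ)
/-- The integer square `hᵀ Λ h` of a lattice vector (the positivity idiom of the period facts). -/
abbrev zsq (h : K3Index → ℤ) : ℤ := ∑ i, ∑ j, h i * k3Gram i j * h j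

/-- The REACH AXIS `u₀ = (Im σ.h) Re σ − (Re σ.h) Im σ`, spanning `P_σ ∩ h^⊥` (`P_σ = ⟨Re σ, Im σ⟩`). -/
def reachAxis (σ : K3Index → ℂ) (h : K3Index → ℤ) : K3Index → ℝ :=
  bR (imV σ) (ofZR h) • reV σ - bR (reV σ) (ofZR h) • imV σ

/-- The REACH POINT `x_v = u₀ + i v`. -/
def reachPoint (σ : K3Index → ℂ) (h : K3Index → ℤ) (v : K3Index → ℝ) : K3Index → ℂ :=
  fun i => ((reachAxis σ h i : ℝ) : ℂ) + ((v i : ℝ) : ℂ) * Complex.I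

/-- The three-space `⟨Re σ, Im σ, v⟩`. -/
abbrev span3 (σ : K3Index → ℂ) (v : K3Index → ℝ) : Submodule ℝ (K3Index → ℝ) :=
  Submodule.span ℝ {reV σ, imV σ, v}

/-- ADMISSIBLE direction: `v ⊥ u₀`, `v ⊥ h`, `v² = u₀²`, and `⟨Re σ, Im σ, v⟩` a positive three-space. -/
def Admissible (σ : K3Index → ℂ) (h : K3Index → ℤ) (v : K3Index → ℝ) : Prop :=
  bR (reachAxis σ h) v = 0 ∧ bR (ofZR h) v = 0 ∧ bR v v = bR (reachAxis σ h) (reachAxis σ h) ∧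
    IsPositiveThreeSpace (span3 σ v)

/-- Rational 2-SIMILITUDE of the K3 lattice: `Mᵀ Λ M = 2Λ`, i.e. `(Mx.My) = 2(x.y)`. -/
def IsTwoSimilitude (M : Matrix K3Index K3Index ℚ) : Prop :=
  M.transpose * k3Gram.map (Int.cast : ℤ → ℚ) * M = (2 : ℚ) • k3Gram.map (Int.cast : ℤ → ℚ)

/-- The similitude acting on `Λ_ℂ`. -/
abbrev simC (M : Matrix K3Index K3Index ℚ) : (K3Index → ℂ) →ₗ[ℂ] (K3Index → ℂ) :=
  Matrix.toLin' (M.map (fun q : ℚ => (q : ℂ)))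

/-- MARKED PROJECTIVE K3 WITH PERIOD `x`: the six marking clauses common to the conclusions of the tree facts
`Huybrechts_K3_periodSurjective_projective` and `Huybrechts_K3_marking_exists` (integral generator `p` of `H⁴`,
integral classes `= φ⁻¹(ℤ²²)`, `a ∪ b = (φa.φb) p`, `φ⁻¹ x` spans the `(2,0)`-classes). -/
def IsMarkedAt (S : Motives.SchemeOver ℂ) (φ : HodgeTheory.complexBetti S (2 * 1) ≃ₗ[ℂ] (K3Index → ℂ))
    (p : HodgeTheory.complexBetti S (2 * 2)) (x : K3Index → ℂ) : Prop :=
  HodgeTheory.IsIntegralClass p ∧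
  (∀ q : HodgeTheory.complexBetti S (2 * 2), HodgeTheory.IsIntegralClass q → ∃ n : ℤ, q = n • p) ∧
  (∀ c : HodgeTheory.complexBetti S (2 * 1),
      HodgeTheory.IsIntegralClass c ↔ ∃ v : K3Index → ℤ, φ c = fun i => (v i : ℂ)) ∧
  (∀ a b : HodgeTheory.complexBetti S (2 * 1),
      cupProduct (rfl : 2 * 1 + 2 * 1 = 2 * 2) a b = k3Form (φ a) (φ b) • p) ∧
  HodgeTheory.IsOfHodgeType 2 S (2 * 1) 2 0 (φ.symm x) ∧
  (∀ τ : HodgeTheory.complexBetti S (2 * 1),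
      HodgeTheory.IsOfHodgeType 2 S (2 * 1) 2 0 τ → ∃ t : ℂ, τ = t • φ.symm x)

/-- GRAPH-ALGEBRAICITY AT A PERIOD (scheme level, in the idiom of `TwinSimilitudeAlgebraic` /
`Buskin2019_hodgeIsometry_algebraic`): for all marked projective K3 `(S, φ, p)` with period `x` and `(S′, φ′, p′)`
with period `x′`, `M x′ = x`, the map `φ⁻¹ ∘ M ∘ φ′ : H²(S′(ℂ);ℂ) → H²(S(ℂ);ℂ)` is `[γ]_* = fst_*(snd^*(–) ∪ γ)`
for some `γ ∈ algebraicClasses (S ⊗ S′) 2`.  Invariant under `x ↦ c x`, `c ≠ 0`. -/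
def GraphAlgebraicAt (M : Matrix K3Index K3Index ℚ) (x : K3Index → ℂ) : Prop :=
  ∀ (μ : HodgeTheory.OrientationFamily), μ.HasPoincareDuality →
    ∀ (S S' : Motives.SchemeOver ℂ) (hS : IsK3Surface S) (hS' : IsK3Surface S')
      (φ : HodgeTheory.complexBetti S (2 * 1) ≃ₗ[ℂ] (K3Index → ℂ)) (p : HodgeTheory.complexBetti S (2 * 2))
      (φ' : HodgeTheory.complexBetti S' (2 * 1) ≃ₗ[ℂ] (K3Index → ℂ))
      (p' : HodgeTheory.complexBetti S' (2 * 2)) (x' : K3Index → ℂ),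
      IsMarkedAt S φ p x → IsMarkedAt S' φ' p' x' → simC M x' = x →
        ∃ γ ∈ HodgeTheory.algebraicClasses (MonoidalCategoryStruct.tensorObj S S') 2,
          ∀ y : HodgeTheory.complexBetti S' (2 * 1),
            φ.symm (simC M (φ' y)) =
              HodgeTheory.complexGysin μ (Motives.IsSmoothProjective.tensor_holds hS.1 hS'.1) hS.1
                (SemiCartesianMonoidalCategory.fst S S')
                (rfl : 2 * 1 + 2 * 2 + 2 * 2 = 2 * 1 + 2 * (2 + 2))
                (cupProduct (rfl : 2 * 1 + 2 * 2 = 2 * 1 + 2 * 2)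
                  (HodgeTheory.complexBetti.map (SemiCartesianMonoidalCategory.snd S S') (2 * 1) y) γ)

/-- LOCUS STRUCTURE of a predicate `P` on `D_h` ("the `P`-locus is locally a countable union of `ℂ*`-saturated
closed analytic subsets"): around every point of `D_h` there are an open `U ∋ x` of `Λ_ℂ` and sets `Z n` with
`P ↔ ⋃ Z n` on `U ∩ D_h`, each `Z n` saturated under `y ↦ c y` inside `U` and cut out, near every point of
`U ∩ D_h`, by finitely many holomorphic functions on an open set of `Λ_ℂ`. -/
def LocusStructure (P : (K3Index → ℂ) → Prop) (h : K3Index → ℤ) : Prop :=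
  ∀ x ∈ k3PeriodDomain, k3Form (ofZ h) x = 0 →
    ∃ U : Set (K3Index → ℂ), IsOpen U ∧ x ∈ U ∧
      ∃ Z : ℕ → Set (K3Index → ℂ),
        (∀ y ∈ U, y ∈ k3PeriodDomain → k3Form (ofZ h) y = 0 → (P y ↔ ∃ n, y ∈ Z n)) ∧
        ∀ n, (∀ c : ℂ, c ≠ 0 → ∀ y ∈ Z n, y ∈ U → c • y ∈ U → c • y ∈ Z n) ∧
          ∀ y ∈ U, y ∈ k3PeriodDomain → k3Form (ofZ h) y = 0 →
            ∃ U' : Set (K3Index → ℂ), IsOpen U' ∧ y ∈ U' ∧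
              ∃ (k : ℕ) (f : Fin k → (K3Index → ℂ) → ℂ), (∀ j, AnalyticOnNhd ℂ (f j) U') ∧
                ∀ z ∈ U', z ∈ U → z ∈ k3PeriodDomain → k3Form (ofZ h) z = 0 →
                  (z ∈ Z n ↔ ∀ j, f j z = 0)

/-! ### §1 The six statements of the line -/

/-- STATEMENT 1 — REACH GEOMETRY at `(σ, h)` with `u₀ ≠ 0`.  R1: for an admissible `v`, the points `x_{±v}`
are orthogonal to `h` and lie on the twistor line of `⟨Re σ, Im σ, v⟩` (in particular in `D`).  R2/R3: for
every open `U ∋ ω₀` with `⟨Re σ, Im σ, ω₀⟩` positive there is an open `V` containing an admissible direction such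
that every admissible `v ∈ V` has `⟨Re σ, Im σ, v⟩ = ⟨Re σ, Im σ, ω⟩` for some `ω ∈ U` (every positive
three-space through `P_σ` is reached, openly).  TR: TOTAL REALITY / transversality at the cone level — every
tangent vector `ξ` of the cone `C_h = {x² = 0} ∩ h^⊥` at `x_v` decomposes UNIQUELY as `c·x_v + i δ` with
`δ ∈ ⟨u₀, h, v⟩^⊥ ⊗ ℂ`. -/
def ReachGeometry : Prop :=
  ∀ σ ∈ k3PeriodDomain, ∀ h : K3Index → ℤ, reachAxis σ h ≠ 0 →
    (∀ v : K3Index → ℝ, Admissible σ h v →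
        k3Form (ofZ h) (reachPoint σ h v) = 0 ∧ k3Form (ofZ h) (reachPoint σ h (-v)) = 0 ∧
        reachPoint σ h v ∈ k3TwistorLine (span3 σ v) ∧ reachPoint σ h (-v) ∈ k3TwistorLine (span3 σ v)) ∧
    (∀ U : Set (K3Index → ℝ), IsOpen U → ∀ ω₀ ∈ U, IsPositiveThreeSpace (span3 σ ω₀) →
        ∃ V : Set (K3Index → ℝ), IsOpen V ∧ (∃ v ∈ V, Admissible σ h v) ∧
          ∀ v ∈ V, Admissible σ h v → ∃ ω ∈ U, span3 σ v = span3 σ ω) ∧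
    (∀ v : K3Index → ℝ, Admissible σ h v → ∀ ξ : K3Index → ℂ,
        k3Form (reachPoint σ h v) ξ = 0 → k3Form (ofZ h) ξ = 0 →
        ∃! cd : ℂ × (K3Index → ℂ),
          k3Form (ofR (reachAxis σ h)) cd.2 = 0 ∧ k3Form (ofZ h) cd.2 = 0 ∧ k3Form (ofR v) cd.2 = 0 ∧
            ξ = cd.1 • reachPoint σ h v + Complex.I • cd.2)

/-- STATEMENT 2 — IDENTITY PRINCIPLE FOR THE REAL FORM `ℝⁿ ⊂ ℂⁿ`: an analytic function on a connected open set
of `ℂⁿ` vanishing on a non-empty open piece of the real points vanishes identically. -/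
def IdentityPrincipleFlat : Prop :=
  ∀ (n : ℕ) (f : (Fin n → ℂ) → ℂ) (U : Set (Fin n → ℂ)), IsOpen U → IsPreconnected U →
    AnalyticOnNhd ℂ f U →
    ∀ V : Set (Fin n → ℝ), IsOpen V → V.Nonempty →
      (∀ t ∈ V, (fun i => (t i : ℂ)) ∈ U) → (∀ t ∈ V, f (fun i => (t i : ℂ)) = 0) →
      ∀ z ∈ U, f z = 0

/-- STATEMENT 3 — SPREAD (conditional on statements 1 and 2): for `h² > 0`, `σ ∈ D` with `u₀ ≠ 0`, a predicate
with `LocusStructure` on `D_h` that holds at `x_v` and `x_{−v}` for every admissible `v` of some open set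
containing an admissible direction holds on all of `D_h`. -/
def Spread : Prop :=
  ReachGeometry → IdentityPrincipleFlat →
    ∀ (P : (K3Index → ℂ) → Prop) (h : K3Index → ℤ), 0 < zsq h →
      ∀ σ ∈ k3PeriodDomain, reachAxis σ h ≠ 0 → LocusStructure P h →
        (∃ V : Set (K3Index → ℝ), IsOpen V ∧ (∃ v ∈ V, Admissible σ h v) ∧
            ∀ v ∈ V, Admissible σ h v → P (reachPoint σ h v) ∧ P (reachPoint σ h (-v))) →
        ∀ x ∈ k3PeriodDomain, k3Form (ofZ h) x = 0 → P x

/-- STATEMENT 4 — CHOW/DOUADY LOCUS: for a rational 2-similitude `M` and `h² > 0`, graph-algebraicity has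
`LocusStructure` on `D_h`. -/
def ChowLocus : Prop :=
  ∀ M : Matrix K3Index K3Index ℚ, IsTwoSimilitude M →
    ∀ h : K3Index → ℤ, 0 < zsq h → LocusStructure (GraphAlgebraicAt M) h

/-- STATEMENT 5 — ONE-LINE TRANSPORT (LOAD-BEARING; outcome level): there are a rational 2-similitude `M`, an
anchor period `σ` and a non-empty OPEN set `U` of directions making `⟨Re σ, Im σ, ω⟩` positive, such that on every
twistor line `T_{⟨Re σ, Im σ, ω⟩}`, `ω ∈ U`, graph-algebraicity holds at every point orthogonal to any lattice
class of positive square. -/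
def OneLineTransport : Prop :=
  ∃ M : Matrix K3Index K3Index ℚ, IsTwoSimilitude M ∧
    ∃ σ ∈ k3PeriodDomain, ∃ U : Set (K3Index → ℝ), IsOpen U ∧
      (∃ ω ∈ U, IsPositiveThreeSpace (span3 σ ω)) ∧
      ∀ ω ∈ U, IsPositiveThreeSpace (span3 σ ω) →
        ∀ h : K3Index → ℤ, 0 < zsq h →
          ∀ x ∈ k3TwistorLine (span3 σ ω), k3Form (ofZ h) x = 0 → GraphAlgebraicAt M x

/-- STATEMENT 6 — HARVEST (formal debt): the two period facts, Buskin's theorem (route item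
`HodgeIsometryAlgebraic`) and graph-algebraicity on every GOOD polarised period domain (`h² > 0`, `u₀ ≠ 0`) of one
anchor give the route target `TwinSimilitudeAlgebraic`. -/
def Harvest : Prop :=
  Huybrechts_K3_marking_exists → Huybrechts_K3_periodSurjective_projective → HodgeIsometryAlgebraic →
    (∃ M : Matrix K3Index K3Index ℚ, IsTwoSimilitude M ∧ ∃ σ ∈ k3PeriodDomain,
        ∀ h : K3Index → ℤ, 0 < zsq h → reachAxis σ h ≠ 0 →
          ∀ x ∈ k3PeriodDomain, k3Form (ofZ h) x = 0 → GraphAlgebraicAt M x) →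
    TwinSimilitudeAlgebraic

/-- THE CRUX'S TYPED OUTPUT (the informal crux's clause (c), last sentence: "with `HodgeIsometryAlgebraic` this is
X = `TwinSimilitudeAlgebraic`"), under the two standard period facts.  Concluded BY NAME by
`TwinTwistorTransport_of`; `--crux-decl` points here (the crux item itself has no decl). -/
def CruxOutput : Prop :=
  Huybrechts_K3_marking_exists → Huybrechts_K3_periodSurjective_projective → HodgeIsometryAlgebraic →
    TwinSimilitudeAlgebraic

/-! ### §2 The registered stubs `stub_…` (the only `sorry`s of the file) -/

/-- STUB 1 (M, provable now; bilinear algebra on `Λ_ℝ`, API of `K3TwistorLines`) — `ReachGeometry`.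
Why true: R1 `x_v.x_v = u₀² − v² + 2i(u₀.v) = 0`, `x̄_v.x_v = 2u₀² > 0`, `Re/Im x_{±v} ∈ ⟨Re σ, Im σ, v⟩`,
`x_{±v} ⊥ h`; R2 for positive `W ⊇ P_σ`, `W ∩ h^⊥` is a positive 2-plane containing `u₀` (`h|_W ≠ 0` as
`u₀ ≠ 0`), take `v ⊥ u₀` in it with `v² = u₀²` — then `v ∉ P_σ` and `⟨Re σ, Im σ, v⟩ = W`; R3 write
`ω₀ = αReσ + βImσ + γv₀` (`γ ≠ 0` by `finrank = 3`) and put `ω(v) := αReσ + βImσ + γv`, `V := ω⁻¹(U)`;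
TR `c x_v + iδ = 0`, `δ ⊥ u₀` ⇒ `ic u₀² = 0` ⇒ `c = 0 = δ`; existence `c = (u₀.ξ)/u₀²`, `δ = −i(ξ − c x_v)`
(uses `x_v.ξ = 0`, `v² = u₀²`).  Checked by hand by triage r1-1/2/3 (F-E). -/
theorem stub_reachGeometry :
    ∀ σ ∈ k3PeriodDomain, ∀ h : K3Index → ℤ, reachAxis σ h ≠ 0 →
      (∀ v : K3Index → ℝ, Admissible σ h v →
          k3Form (ofZ h) (reachPoint σ h v) = 0 ∧ k3Form (ofZ h) (reachPoint σ h (-v)) = 0 ∧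
          reachPoint σ h v ∈ k3TwistorLine (span3 σ v) ∧ reachPoint σ h (-v) ∈ k3TwistorLine (span3 σ v)) ∧
      (∀ U : Set (K3Index → ℝ), IsOpen U → ∀ ω₀ ∈ U, IsPositiveThreeSpace (span3 σ ω₀) →
          ∃ V : Set (K3Index → ℝ), IsOpen V ∧ (∃ v ∈ V, Admissible σ h v) ∧
            ∀ v ∈ V, Admissible σ h v → ∃ ω ∈ U, span3 σ v = span3 σ ω) ∧
      (∀ v : K3Index → ℝ, Admissible σ h v → ∀ ξ : K3Index → ℂ,
          k3Form (reachPoint σ h v) ξ = 0 → k3Form (ofZ h) ξ = 0 →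
          ∃! cd : ℂ × (K3Index → ℂ),
            k3Form (ofR (reachAxis σ h)) cd.2 = 0 ∧ k3Form (ofZ h) cd.2 = 0 ∧ k3Form (ofR v) cd.2 = 0 ∧
              ξ = cd.1 • reachPoint σ h v + Complex.I • cd.2) := by
  sorry

/-- STUB 2 (M, Mathlib-level, provable now) — `IdentityPrincipleFlat`.  Why true: at a real point `a ∈ U` all
iterated Fréchet derivatives of `f` are `ℂ`-multilinear and vanish on real directions (the restriction of `f` to
the real slice is real-analytic and zero near `a`), and `(ℝⁿ)^k` spans `(ℂⁿ)^k` multilinearly, so the power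
series of `f` at `a` is zero; conclude with Mathlib's several-variable identity theorem
`AnalyticOnNhd.eqOn_zero_of_preconnected_of_eventuallyEq_zero`. -/
theorem stub_identityPrinciple :
    ∀ (n : ℕ) (f : (Fin n → ℂ) → ℂ) (U : Set (Fin n → ℂ)), IsOpen U → IsPreconnected U →
      AnalyticOnNhd ℂ f U →
      ∀ V : Set (Fin n → ℝ), IsOpen V → V.Nonempty →
        (∀ t ∈ V, (fun i => (t i : ℂ)) ∈ U) → (∀ t ∈ V, f (fun i => (t i : ℂ)) = 0) →
        ∀ z ∈ U, f z = 0 := by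
  sorry

/-- STUB 3 (L as a formalisation, soft mathematics) — `Spread`.  Why true (proof plan): (i) `A := {x ∈ D_h | P x}`;
near `x₀ := x_{v₀}` take `U₀, Z` from `LocusStructure`; the admissible `v ∈ V` with `x_v ∈ U₀` form a locally
compact (open ∩ closed in `ℝ²²`) hence Baire space covered by the closed sets `{v | x_v ∈ Z n}`, so some `Z n`
contains `x_v` for all admissible `v` of an open `V₂ ≠ ∅`; (ii) at `v₁ ∈ V₂`: the holomorphic chart
`Φ(c, t) := c (u₀ + i λ(t)(v₁ + t))`, `t ∈ ⟨u₀, h, v₁⟩^⊥ ⊗ ℂ ≅ ℂ¹⁹`, `λ(t) = (u₀²/(v₁+t)²)^{1/2}`, has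
differential `(c, t) ↦ c x_{v₁} + i t` (TR: bijective onto `T C_h`) and the EXPLICIT inverse
`c = (u₀.y)/u₀²`, `w = (y/c − u₀)/i`, `t = (v₁²/(v₁.w)) w − v₁` on `C_h` near `x_{v₁}`, so `Φ` maps a ball onto
a neighbourhood of `x_{v₁}` in `C_h`; the defining functions `f_j` of `Z n` near `x_{v₁}` pulled back by `Φ`
vanish for `c` complex near `1` and `t` REAL (saturation of `Z n`, `c x_v ∈ Z n`), hence on the real form of
`ℂ × ℂ¹⁹`, hence identically (`IdentityPrincipleFlat`, `n = 20`) ⇒ `x_{v₁} ∈ Int_{D_h} A`; same at `−v₁`;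
(iii) `O := Int_{D_h} A` is closed in `D_h`: at `y ∈ D_h ∩ closure O` use the same chart centred at `y`
(`Re y ⊥ Im y`, equal squares, both `⊥ h` — needs `h² > 0` for `dim = 19`) on a ball, Baire on the open piece
`O ∩` chart image, and the identity theorem on the connected ball ⇒ `y ∈ O`; (iv) `D_h` has two connected
components (oriented positive 2-frames in `h^⊥_ℝ ≅ ℝ^{2,19}`), exchanged by `x_v ↦ x_{−v} = x̄_v`, so the clopen
`O` containing `x_{±v₁}` is `D_h`. -/
theorem stub_spread :
    ReachGeometry → IdentityPrincipleFlat →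
      ∀ (P : (K3Index → ℂ) → Prop) (h : K3Index → ℤ), 0 < zsq h →
        ∀ σ ∈ k3PeriodDomain, reachAxis σ h ≠ 0 → LocusStructure P h →
          (∃ V : Set (K3Index → ℝ), IsOpen V ∧ (∃ v ∈ V, Admissible σ h v) ∧
              ∀ v ∈ V, Admissible σ h v → P (reachPoint σ h v) ∧ P (reachPoint σ h (-v))) →
          ∀ x ∈ k3PeriodDomain, k3Form (ofZ h) x = 0 → P x := by
  sorry

/-- STUB 4 (L/XL; typed statement, proof needs relative Douady/Chow spaces — not in the tree) — `ChowLocus`.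
Why true: near `x ∈ D_h` the Kuranishi families of a marked `S_x` and of its `M`-partner restrict to a smooth
proper Kähler family of products over `U ∩ D_h` (local Torelli); by Fujiki the components of the relative
Douady (or Barlet) space are countably many and PROPER over the base, with locally constant fibre classes, so
`{y | some algebraic class has H²⊗H²-component graph(M)_y}` is a countable union of closed analytic subsets
of `U ∩ ℙ(D_h)` (images of component pairs with the right class difference), saturated as cones; "for ALL
markings over `y`" equals "for one" because markings over `y` differ by `±W_y` (Weyl reflections
`s_C = [Δ + C × C]_*` and `−1 = −[Δ]_*` are algebraic, Buskin 2019 Prop. 6.2; composition Lemma 6.3 =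
tree `K3CorrespondenceComposition`); algebraic = analytic cycles on the projective fibres (Chow/GAGA, tree
`Motives/GAGA`).  Sources: Fujiki (Publ. RIMS 14 (1978) 1–52; closedness/properness of the Douady space of
Kähler morphisms), Voisin, Hodge Theory II Ch. 5 §3 (structure of the locus of algebraic classes),
Huybrechts2016K3 Ch. 6 §2–3 (local Torelli, Kuranishi family), Buskin2019 Prop. 6.2 / Lemma 6.3. -/
theorem stub_locus :
    ∀ M : Matrix K3Index K3Index ℚ, IsTwoSimilitude M →
      ∀ h : K3Index → ℤ, 0 < zsq h → LocusStructure (GraphAlgebraicAt M) h := by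
  sorry

/-- STUB 5 (XL, LOAD-BEARING, research content; typed at OUTCOME level because hyperkähler metrics / twistor
families / hyperholomorphic sheaves / analytic Chern classes have no tree notions yet) — `OneLineTransport`.
Informal proof obligation (the mechanism): `M` = the rational completed-Nikulin 2-similitude class of the
anchor (Ψ in marked coordinates: rational, `2M` integral — cdisprove gen-1 — never assumed integral here), `σ` = the marked period of a generic member `X` of an EVEN-degree
Nikulin family (`Negative/AnchorConeCondition`: `𝒦_X = 𝒞⁺_X`), `U = Ψ(𝒦_{Y′}) ∩ 𝒮` with `𝒮` the OPEN cone of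
matched classes for which the 14464 carrier `G` (locally free, slope-STABLE — `Negative/PolystableCrossTerm` —
with `c₂(G)^{H²⊗H²} = m·graph Ψ`) is Ψ-matched hyperholomorphic (Markman 2024 Prop. 5.19 (i); openness of
stability GRT arXiv:1409.7564 Thm 2.8; `Negative/GenericFirstLine`: an open cone, never one rational ray);
for `ω ∈ U`: Calabi–Yau metrics in the classes `ω`, `Ψ⁻¹ω`, product hyperkähler structure on `X × Y′`
(frames intertwined: rattack `FrameIntertwine.lean`), Kaledin–Verbitsky (alg-geom/9712012 Thm 3.19/3.27;
twisted: Markman 1105.3223 §7) reflexive extension of `G` over the diagonal twistor line, whose periods are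
`T_{⟨Re σ, Im σ, ω⟩}` and `M⁻¹` of it; at `x ∈ T_W ∩ h^⊥` both fibres are projective (`h`, `N·M⁻¹h`), the
restricted sheaf is algebraic (GAGA, tree `Motives/GAGA`), its `c₂` is an algebraic class whose mixed Künneth
component is still `m·graph` (flat transport of a topological class; at special fibres by
`twin-no-trianalytic-correspondence-conservation`), divide by `m`; all markings over `x` by Torelli
(Huybrechts2016K3 Ch. 7 Thm 5.3) + algebraic Weyl reflections (Buskin Prop. 6.2).  At `h ⊥ P_σ` the only
points are `σ, σ̄` (the anchor: `[Γ]` algebraic).  HC implies the typed statement trivially; its refutation is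
a refutation of HC — the risk of this stub is the informal mechanism (kill: the 14464 carrier does not exist
on an open cone, or K–V fails for the Ψ-matched product), recorded on 14464/14522. -/
theorem stub_transport :
    ∃ M : Matrix K3Index K3Index ℚ, IsTwoSimilitude M ∧
      ∃ σ ∈ k3PeriodDomain, ∃ U : Set (K3Index → ℝ), IsOpen U ∧
        (∃ ω ∈ U, IsPositiveThreeSpace (span3 σ ω)) ∧
        ∀ ω ∈ U, IsPositiveThreeSpace (span3 σ ω) →
          ∀ h : K3Index → ℤ, 0 < zsq h →
            ∀ x ∈ k3TwistorLine (span3 σ ω), k3Form (ofZ h) x = 0 → GraphAlgebraicAt M x := by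
  sorry

/-- STUB 6 (L, formal debt, no research risk) — `Harvest`.  Why true: given `μ`, K3 surfaces `S, S′`,
generators `p, p′` and a rational type-preserving 2-similitude `ψ : H²(S′) → H²(S)`: mark `S`
(`Huybrechts_K3_marking_exists`: `φ, p_S, x_S`, ample lattice vector `u ⊥ x_S`, `u² > 0`); RE-MARK by some
`γ ∈ O(Λ_K3)` so that `h := γu` has `reachAxis σ h ≠ 0` (the `O(Λ)`-orbit of a vector is not contained in
the proper sublattice `P_σ^⊥ ∩ Λ`: `O(Λ_K3)` acts `ℚ`-irreducibly; Huybrechts2016K3 Ch. 14 §1–2); then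
`x := γ x_S ∈ D_h` and the hypothesis gives `GraphAlgebraicAt M x`; build the `M`-PARTNER `(S″, φ″, p″)` at
`x″ := M⁻¹x` by `Huybrechts_K3_periodSurjective_projective` (`x″² = 0`, `x̄″x″ > 0`, lattice vector
`N·M⁻¹h ⊥ x″` of positive square), so `ψ₀ := (γφ)⁻¹ ∘ M ∘ φ″ = [γ₀]_*` is an ALGEBRAIC rational Hodge
2-similitude `H²(S″) → H²(S)` (bookkeeping with the marking clauses; `p = ±p_S`, the sign `−` being vacuous
by signatures `(3,19) ≠ (19,3)`); `ψ₀⁻¹ ∘ ψ : H²(S′) → H²(S″)` is a rational, type-preserving ISOMETRY, hence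
`[γ₁]_*` by `HodgeIsometryAlgebraic`; `ψ = ψ₀ ∘ [γ₁]_* = [γ₀ ∘ γ₁]_*` is algebraic by composition of
correspondences (Buskin Lemma 6.3 = tree `K3CorrespondenceComposition.corrComp_of_baseChange`, granted its
(hBC)/(hCUP) inputs, and `K3SurfaceProofs`).  Sources: Buskin2019 §6, Huybrechts2016K3 Ch. 14, Fulton1998
Ch. 16. -/
theorem stub_harvest :
    Huybrechts_K3_marking_exists → Huybrechts_K3_periodSurjective_projective → HodgeIsometryAlgebraic →
      (∃ M : Matrix K3Index K3Index ℚ, IsTwoSimilitude M ∧ ∃ σ ∈ k3PeriodDomain,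
          ∀ h : K3Index → ℤ, 0 < zsq h → reachAxis σ h ≠ 0 →
            ∀ x ∈ k3PeriodDomain, k3Form (ofZ h) x = 0 → GraphAlgebraicAt M x) →
      TwinSimilitudeAlgebraic := by
  sorry

/-! ### §3 Name-keyed aliases of the six statements (the hypotheses of the composition)

`__Registered.stub_X` is statement `X` under the registered stub's short name, so that the native skeleton audit
(`#h21_check_skeleton`: hypotheses admissible iff registered obligations / declared stubs BY NAME) accepts
`TwinTwistorTransport_of : __Registered.stub_… → … → CruxOutput` (device of
`Cruxes/LoopsToCrossings/Lines/br-sandwich-diagonal.lean`); `cruxOutput_proof` applies the composition to the six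
`stub_…` literally, which checks that statements, aliases and stubs agree. -/
namespace __Registered
/-- Alias of `ReachGeometry` keyed by the registered stub name. -/
abbrev stub_reachGeometry : Prop := ReachGeometry
/-- Alias of `IdentityPrincipleFlat` keyed by the registered stub name. -/
abbrev stub_identityPrinciple : Prop := IdentityPrincipleFlat
/-- Alias of `Spread` keyed by the registered stub name. -/
abbrev stub_spread : Prop := Spread
/-- Alias of `ChowLocus` keyed by the registered stub name. -/
abbrev stub_locus : Prop := ChowLocus
/-- Alias of `OneLineTransport` keyed by the registered stub name. -/
abbrev stub_transport : Prop := OneLineTransport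
/-- Alias of `Harvest` keyed by the registered stub name. -/
abbrev stub_harvest : Prop := Harvest
end __Registered

/-! ### §4 The composition (kernel-checked, no `sorry`) -/

/-- **The crux output from the six stubs.**  Unpack `stub_transport` (`M, σ, U, ω₀`); `stub_harvest` reduces
`CruxOutput` to graph-algebraicity on every good `D_h`; for such `h`, `stub_spread` (fed `stub_reachGeometry`,
`stub_identityPrinciple`, the locus structure `stub_locus M h`) reduces it to graph-algebraicity at `x_{±v}` for
the admissible `v` of an open set — which `stub_reachGeometry` R2/R3 produces from `U ∋ ω₀` (every admissible
`v ∈ V` spans, with `P_σ`, the three-space of some `ω ∈ U`) and R1 places on the line `T_{⟨Re σ, Im σ, ω⟩}`,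
orthogonal to `h`, where `stub_transport` applies. -/
theorem TwinTwistorTransport_of (hR : __Registered.stub_reachGeometry)
    (hI : __Registered.stub_identityPrinciple) (hS : __Registered.stub_spread)
    (hL : __Registered.stub_locus) (hT : __Registered.stub_transport)
    (hH : __Registered.stub_harvest) : CruxOutput := by
  intro hMark hSurj hBuskin
  obtain ⟨M, hM, σ, hσ, U, hUo, ⟨ω₀, hω₀U, hω₀pos⟩, hline⟩ := hT
  refine hH hMark hSurj hBuskin ⟨M, hM, σ, hσ, ?_⟩
  intro h hh hu x hx hxh
  obtain ⟨hR1, hR23, -⟩ := hR σ hσ h hu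
  obtain ⟨V, hVo, hVne, hVU⟩ := hR23 U hUo ω₀ hω₀U hω₀pos
  refine hS hR hI (GraphAlgebraicAt M) h hh σ hσ hu (hL M hM h hh) ⟨V, hVo, hVne, ?_⟩ x hx hxh
  intro v hv hadm
  obtain ⟨ω, hωU, hspan⟩ := hVU v hv hadm
  obtain ⟨hxh₁, hxh₂, hxW₁, hxW₂⟩ := hR1 v hadm
  have hposW : IsPositiveThreeSpace (span3 σ ω) := hspan ▸ hadm.2.2.2
  rw [hspan] at hxW₁ hxW₂
  exact ⟨hline ω hωU hposW h hh _ hxW₁ hxh₁, hline ω hωU hposW h hh _ hxW₂ hxh₂⟩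

/-- The same composition with the route TARGET as its literal conclusion (for readers and for a future
re-pointing of `--crux-decl` once the two period facts are route items). -/
theorem twinSimilitudeAlgebraic_of_line (hR : __Registered.stub_reachGeometry)
    (hI : __Registered.stub_identityPrinciple) (hS : __Registered.stub_spread)
    (hL : __Registered.stub_locus) (hT : __Registered.stub_transport)
    (hH : __Registered.stub_harvest) (hMark : Huybrechts_K3_marking_exists)
    (hSurj : Huybrechts_K3_periodSurjective_projective) (hBuskin : HodgeIsometryAlgebraic) :
    TwinSimilitudeAlgebraic :=
  TwinTwistorTransport_of hR hI hS hL hT hH hMark hSurj hBuskin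

/-- `CruxOutput`, unfolded, from the six registered stubs literally (checks that statements, aliases and stubs
agree; inherits their `sorry`s — closed once they land; stated unfolded so that `TwinTwistorTransport_of` is the
unique theorem whose conclusion HEAD is `CruxOutput`, i.e. the one the skeleton audit analyses). -/
theorem cruxOutput_proof :
    Huybrechts_K3_marking_exists → Huybrechts_K3_periodSurjective_projective → HodgeIsometryAlgebraic →
      TwinSimilitudeAlgebraic :=
  TwinTwistorTransport_of stub_reachGeometry stub_identityPrinciple stub_spread stub_locus stub_transport
    stub_harvest

end Summit.HodgeConjecture.HodgeConjecture.Cruxes.TwinTwistorTransport.OneLineTotallyRealReach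

end

-- Native skeleton audit (the same line `ledger skeleton check --crux-decl …CruxOutput` appends): one info line
-- `{"h21_check_skeleton": …, "ok": true, "theorem": "…TwinTwistorTransport_of", "closed": false, …}`.
#h21_check_skeleton "stmt-HodgeConjecture-14522" Summit.HodgeConjecture.HodgeConjecture.Cruxes.TwinTwistorTransport.OneLineTotallyRealReach.CruxOutput stub_reachGeometry stub_identityPrinciple stub_spread stub_locus stub_transport stub_harvest
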